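import Mathlib
import HarnessLib
import Summits.Ventures.LatticeQCDFlow.Exactness.SubsphereUniform

/-!
# Coordinate blocks of a standard Gaussian vector: independence (convolution form), shrinking, and the radial (chi) law

HONEST FRAMING: exact (Metropolis-corrected) sampling algorithms for lattice gauge theory;
figures of merit are autocorrelation/cost numbers at stated couplings and volumes; no
continuum-physics claim.

Venture `LatticeQCDFlow` (cell pub-lqcd), topic `Exactness`, FANOUT row 9 (eng-latcore, the
engine `latflow.core`; `update_link` in `csrc/latcore_template.c` runs one Cabibbo–Marinari
heat-bath hit per coordinate pair).  NEW WORK of the cell over Mathlib and row 9's earlier files;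
nothing is cited as a fact.  Part of the proof that the SU(N ≥ 3) Cabibbo–Marinari heat bath is
uniformly ergodic (the convolution of the SU(2)-pair Haar measures dominates Haar on `SU(N)`).

## What is proved (`n` a finite nonempty index type, `E n = ℝ^{n ⊕ n} ≅ ℂ^n`, `S n` its unit sphere)

* §1 `inner_projE_left`, `norm_projE_union_sq`, `projE_projE`, `projE_add_projE`;
  `charFun_stdGaussian_map_projE` (`= exp (−‖p_A t‖²/2)`);
  **`stdGaussian_map_projE_conv`** — for disjoint coordinate sets `A`, `B`:
  `(γ.map p_A) ∗ (γ.map p_B) = γ.map p_{A ∪ B}` (characteristic functions);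
  **`stdGaussian_map_projE_pair`** — the joint law of `(p_A G, p_B G)` is the product of the block
  laws (independence of disjoint Gaussian blocks).
* §2 **`stdGaussian_map_smul_le`** — `law(c G) ≤ |c^{−dim}| · law(G)` for `0 < c ≤ 1` (density
  comparison through `stdGaussian_eq_withDensity_radial` and `Measure.map_addHaar_smul`).
* §3 `RC s`, `card_RC` (`= 2|s|`), `resE`, `norm_resE`, `stdGaussian_map_resE` (a block of a standard
  Gaussian vector is a standard Gaussian vector of the block);
  **`stdGaussian_map_norm_projE`** — the law of `‖p_s G‖` is `K_s · r^{2|s|−1} e^{−r²/2} dr` on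
  `(0, ∞)` with `0 < K_s < ∞` (`chiConst_ne_zero/_ne_top`).

NOT CLAIMED: named chi-square / Gamma laws (only the density up to its normalising constant is used downstream).
-/

namespace Summit.Ventures.LatticeQCDFlow.Exactness

open Matrix MeasureTheory WithLp Metric Complex ProbabilityTheory Measure Set
open scoped ENNReal

variable {n : Type*} [Fintype n] [DecidableEq n]

/-! ## §1 Coordinate blocks of the standard Gaussian are independent: the convolution identity -/

section Blocks

/-- The projection is self-adjoint: `⟪projE A x, t⟫ = ⟪x, projE A t⟫`. -/
theorem inner_projE_left (A : Finset n) (x t : E n) :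
    @inner ℝ _ _ (projE A x) t = @inner ℝ _ _ x (projE A t) := by
  simp only [PiLp.inner_apply, projE_apply, RCLike.inner_apply, conj_trivial]
  refine Finset.sum_congr rfl fun k _ => ?_
  split_ifs <;> simp

/-- `‖projE A t‖² = Σ_{k : idx k ∈ A} t_k²`. -/
theorem norm_projE_sq (A : Finset n) (t : E n) :
    ‖projE A t‖ ^ 2 = ∑ k, if idxOf k ∈ A then t k ^ 2 else 0 := by
  rw [EuclideanSpace.real_norm_sq_eq]
  refine Finset.sum_congr rfl fun k _ => ?_
  rw [projE_apply]
  split_ifs <;> simp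

/-- For disjoint coordinate sets the squared norms of the projections add up. -/
theorem norm_projE_union_sq {A B : Finset n} (hAB : Disjoint A B) (t : E n) :
    ‖projE (A ∪ B) t‖ ^ 2 = ‖projE A t‖ ^ 2 + ‖projE B t‖ ^ 2 := by
  rw [norm_projE_sq, norm_projE_sq, norm_projE_sq, ← Finset.sum_add_distrib]
  refine Finset.sum_congr rfl fun k _ => ?_
  by_cases hA : idxOf k ∈ A
  · have hB : idxOf k ∉ B := Finset.disjoint_left.1 hAB hA
    simp [hA, hB]
  · by_cases hB : idxOf k ∈ B
    · simp [hA, hB]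
    · simp [hA, hB]

/-- Composing projections intersects the coordinate sets. -/
theorem projE_projE (A B : Finset n) (x : E n) : projE A (projE B x) = projE (A ∩ B) x := by
  ext k
  simp only [projE_apply, Finset.mem_inter]
  by_cases hA : idxOf k ∈ A <;> by_cases hB : idxOf k ∈ B <;> simp [hA, hB]

/-- The empty projection is zero. -/
@[simp] theorem projE_empty (x : E n) : projE (∅ : Finset n) x = 0 := by
  ext k; simp [projE_apply]

/-- The projection is additive. -/
theorem projE_add (A : Finset n) (x y : E n) : projE A (x + y) = projE A x + projE A y := by
  ext k
  simp only [projE_apply, PiLp.add_apply]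
  split_ifs <;> simp

/-- `projE A x + projE B x = projE (A ∪ B) x` for disjoint `A`, `B`. -/
theorem projE_add_projE {A B : Finset n} (hAB : Disjoint A B) (x : E n) :
    projE A x + projE B x = projE (A ∪ B) x := by
  ext k
  simp only [projE_apply, PiLp.add_apply, Finset.mem_union]
  by_cases hA : idxOf k ∈ A
  · have hB : idxOf k ∉ B := Finset.disjoint_left.1 hAB hA
    simp [hA, hB]
  · by_cases hB : idxOf k ∈ B <;> simp [hA, hB]

variable [Nonempty n]

omit [Nonempty n] in
/-- **The characteristic function of a Gaussian coordinate block**: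
`charFun (γ.map projE A) t = exp (−‖projE A t‖²/2)`. -/
theorem charFun_stdGaussian_map_projE (A : Finset n) (t : E n) :
    charFun ((stdGaussian (E n)).map (projE A)) t = Complex.exp (-(‖projE A t‖ ^ 2 : ℝ) / 2) := by
  rw [charFun_apply, integral_map (measurable_projE A).aemeasurable
    (Measurable.aestronglyMeasurable (by fun_prop))]
  simp_rw [inner_projE_left A _ t]
  rw [← charFun_apply, charFun_stdGaussian]
  push_cast
  ring_nf

omit [Nonempty n] in
/-- **Disjoint coordinate blocks of a standard Gaussian vector are independent** (convolution
form): the sum of independent copies of the `A`-block and the `B`-block has the law of the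
`A ∪ B`-block. -/
theorem stdGaussian_map_projE_conv {A B : Finset n} (hAB : Disjoint A B) :
    ((stdGaussian (E n)).map (projE A)) ∗ ((stdGaussian (E n)).map (projE B)) =
      (stdGaussian (E n)).map (projE (A ∪ B)) := by
  apply Measure.ext_of_charFun
  funext t
  rw [charFun_conv, charFun_stdGaussian_map_projE, charFun_stdGaussian_map_projE,
    charFun_stdGaussian_map_projE, ← Complex.exp_add, norm_projE_union_sq hAB]
  push_cast
  ring_nf

omit [Nonempty n] in
/-- **Joint law of two disjoint blocks = product of the block laws** (independence proper). -/
theorem stdGaussian_map_projE_pair {A B : Finset n} (hAB : Disjoint A B) :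
    (stdGaussian (E n)).map (fun x => (projE A x, projE B x)) =
      ((stdGaussian (E n)).map (projE A)).prod ((stdGaussian (E n)).map (projE B)) := by
  set γ := stdGaussian (E n) with hγ
  -- `Ψ w = (p_A w, p_B w)` splits a vector back into its blocks
  set Ψ : E n → E n × E n := fun w => (projE A w, projE B w) with hΨ
  have hΨm : Measurable Ψ := (measurable_projE A).prodMk (measurable_projE B)
  have hadd : Measurable fun q : E n × E n => q.1 + q.2 := measurable_fst.add measurable_snd
  have hAAB : A ∩ (A ∪ B) = A := Finset.inter_eq_left.mpr Finset.subset_union_left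
  have hBAB : B ∩ (A ∪ B) = B := Finset.inter_eq_left.mpr Finset.subset_union_right
  have hAB0 : A ∩ B = ∅ := Finset.disjoint_iff_inter_eq_empty.mp hAB
  have hBA0 : B ∩ A = ∅ := Finset.disjoint_iff_inter_eq_empty.mp hAB.symm
  -- left side: `Ψ ∘ p_{A ∪ B}`
  have hL : γ.map (fun x => (projE A x, projE B x)) = (γ.map (projE (A ∪ B))).map Ψ := by
    rw [Measure.map_map hΨm (measurable_projE _)]
    congr 1
    funext x
    simp only [hΨ, Function.comp_apply, projE_projE, hAAB, hBAB]
  -- right side: a push-forward of `γ ⊗ γ` fixed by `Ψ ∘ (+)`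
  have hR : (γ.map (projE A)).prod (γ.map (projE B)) =
      (((γ.map (projE A)).prod (γ.map (projE B))).map (fun q : E n × E n => q.1 + q.2)).map Ψ := by
    rw [Measure.map_prod_map γ γ (measurable_projE A) (measurable_projE B),
      Measure.map_map hadd ((measurable_projE A).prodMap (measurable_projE B)),
      Measure.map_map hΨm (hadd.comp ((measurable_projE A).prodMap (measurable_projE B)))]
    congr 1
    funext q
    obtain ⟨x, y⟩ := q
    simp only [hΨ, Function.comp_apply, Prod.map_apply, projE_add, projE_projE, Finset.inter_self,
      hAB0, hBA0, projE_empty, add_zero, zero_add]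
  rw [hL, hR]
  congr 1
  rw [← stdGaussian_map_projE_conv hAB]
  rfl

end Blocks

/-! ## §2 Shrinking a standard Gaussian vector costs at most a constant factor -/

section Scale

variable [Nonempty n]

omit [DecidableEq n] [Nonempty n] in
/-- **`law(c G) ≤ c^{−2N} law(G)`** for a standard Gaussian vector `G` of `ℝ^{2N}` and `0 < c ≤ 1`
(the `N(0, c²)` density is at most `c^{−2N}` times the `N(0, 1)` density). -/
theorem stdGaussian_map_smul_le {c : ℝ} (hc : 0 < c) (hc1 : c ≤ 1) :
    (stdGaussian (E n)).map (fun x => c • x) ≤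
      ENNReal.ofReal |(c ^ Module.finrank ℝ (E n))⁻¹| • stdGaussian (E n) := by
  set e : E n ≃ᵐ E n := (Homeomorph.smulOfNeZero c hc.ne').toMeasurableEquiv with he
  have hecoe : (e : E n → E n) = fun x => c • x := rfl
  set f : E n → ℝ≥0∞ := fun x => gaussRadial (Fintype.card (n ⊕ n)) ‖x‖ with hf
  have hfm : Measurable f := (measurable_gaussRadial _).comp measurable_norm
  have hγ : stdGaussian (E n) = (volume : Measure (E n)).withDensity f :=
    stdGaussian_eq_withDensity_radial (n ⊕ n)
  -- `f = (f ∘ e.symm) ∘ e`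
  have hfe : f = (f ∘ e.symm) ∘ e := by
    funext x; simp
  have hsymm : ∀ x : E n, e.symm x = c⁻¹ • x := fun x => by
    apply e.injective
    rw [e.apply_symm_apply, hecoe]
    simp [smul_smul, mul_inv_cancel₀ hc.ne']
  rw [hγ, ← hecoe, hfe, map_withDensity_equiv volume e (hfm.comp e.symm.measurable), ← hfe, hecoe,
    Measure.map_addHaar_smul volume hc.ne', withDensity_smul_measure]
  have hmono : (volume : Measure (E n)).withDensity (f ∘ e.symm) ≤ volume.withDensity f := by
    refine withDensity_mono (ae_of_all _ fun x => ?_)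
    simp only [Function.comp_apply, hsymm, hf, gaussRadial, norm_smul, Real.norm_eq_abs,
      abs_inv, abs_of_pos hc]
    refine ENNReal.ofReal_le_ofReal (mul_le_mul_of_nonneg_left ?_ (by positivity))
    refine Real.exp_le_exp.2 (div_le_div_of_nonneg_right (neg_le_neg ?_) zero_le_two)
    have h1 : ‖x‖ ≤ c⁻¹ * ‖x‖ := le_mul_of_one_le_left (norm_nonneg _) (one_le_inv_iff₀.2 ⟨hc, hc1⟩)
    nlinarith [norm_nonneg x]
  refine Measure.le_iff.2 fun t ht => ?_
  rw [Measure.smul_apply, Measure.smul_apply, smul_eq_mul, smul_eq_mul]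
  exact mul_le_mul_right (Measure.le_iff'.1 hmono t) _

end Scale

/-! ## §3 The radial law of a Gaussian coordinate block (chi law with `2|s|` degrees of freedom) -/

section Chi

/-- The real coordinates belonging to the complex coordinates in `s`. -/
abbrev RC (s : Finset n) := {k : n ⊕ n // idxOf k ∈ s}

/-- `RC s ≃ s ⊕ s` (real and imaginary parts). -/
def rcEquiv (s : Finset n) : RC s ≃ (s ⊕ s) where
  toFun k := match k with
    | ⟨Sum.inl a, h⟩ => Sum.inl ⟨a, h⟩
    | ⟨Sum.inr a, h⟩ => Sum.inr ⟨a, h⟩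
  invFun := Sum.elim (fun a => ⟨Sum.inl a.1, a.2⟩) (fun a => ⟨Sum.inr a.1, a.2⟩)
  left_inv := by rintro ⟨k | k, h⟩ <;> rfl
  right_inv := by rintro (a | a) <;> rfl

/-- `|RC s| = 2 |s|`. -/
theorem card_RC (s : Finset n) : Fintype.card (RC s) = 2 * s.card := by
  rw [Fintype.card_congr (rcEquiv s), Fintype.card_sum, Fintype.card_coe]; ring

/-- Restriction to the real coordinates of `s`, as a vector of `ℝ^{RC s}`. -/
noncomputable def resE (s : Finset n) (x : E n) : EuclideanSpace ℝ (RC s) := toLp 2 (fun k => x k.1)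

omit [DecidableEq n] in
/-- It is measurable. -/
theorem measurable_resE (s : Finset n) : Measurable (resE (n := n) s) :=
  (measurable_toLp 2 _).comp (measurable_pi_lambda _ fun k => (measurable_pi_apply k.1).comp (measurable_ofLp 2 _))

/-- `‖resE s x‖ = ‖projE s x‖`. -/
theorem norm_resE (s : Finset n) (x : E n) : ‖resE s x‖ = ‖projE s x‖ := by
  have h : ‖resE s x‖ ^ 2 = ‖projE s x‖ ^ 2 := by
    rw [EuclideanSpace.real_norm_sq_eq, norm_projE_sq, ← Finset.sum_filter,
      Finset.sum_subtype (Finset.univ.filter fun k : n ⊕ n => idxOf k ∈ s)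
        (p := fun k : n ⊕ n => idxOf k ∈ s) (fun k => by rw [Finset.mem_filter]; simp)]
    rfl
  exact (pow_left_inj₀ (norm_nonneg _) (norm_nonneg _) two_ne_zero).1 h

variable [Nonempty n]

omit [Nonempty n] in
/-- **The restriction of a standard Gaussian vector to a block of coordinates is a standard
Gaussian vector of the block.** -/
theorem stdGaussian_map_resE (s : Finset n) :
    (stdGaussian (E n)).map (resE s) = stdGaussian (EuclideanSpace ℝ (RC s)) := by
  set p : n ⊕ n → Prop := fun k => idxOf k ∈ s with hp
  have hres : (resE s) ∘ (toLp 2 : (n ⊕ n → ℝ) → E n) =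
      (toLp 2) ∘ (Prod.fst ∘ (MeasurableEquiv.piEquivPiSubtypeProd (fun _ : n ⊕ n => ℝ) p)) := by
    funext f; rfl
  rw [← map_pi_eq_stdGaussian, Measure.map_map (measurable_resE s) (measurable_toLp 2 _), hres,
    ← Measure.map_map (measurable_toLp 2 _) (measurable_fst.comp (MeasurableEquiv.measurable _)),
    ← Measure.map_map measurable_fst (MeasurableEquiv.measurable _),
    (measurePreserving_piEquivPiSubtypeProd (fun _ : n ⊕ n => gaussianReal 0 1) p).map_eq,
    Measure.map_fst_prod, measure_univ, one_smul, map_pi_eq_stdGaussian]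

omit [Nonempty n] in
/-- **The radial law of a Gaussian block** (chi law with `2|s|` degrees of freedom): the law of
`‖projE s G‖` is `K_s · r^{2|s|−1} e^{−r²/2} dr` on `(0, ∞)`, with
`K_s = σ(S^{2|s|−1}) (2π)^{−|s|} ∈ (0, ∞)` (`σ` = Mathlib's `volume.toSphere` mass). -/
theorem stdGaussian_map_norm_projE (s : Finset n) (hs : s.Nonempty) :
    (stdGaussian (E n)).map (fun x => ‖projE s x‖) =
      ((volume : Measure (EuclideanSpace ℝ (RC s))).toSphere univ *
          ENNReal.ofReal (((Real.sqrt (2 * Real.pi))⁻¹) ^ (2 * s.card))) •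
        (volume.restrict (Ioi (0 : ℝ))).withDensity
          (fun r => ENNReal.ofReal (r ^ (2 * s.card - 1) * Real.exp (-r ^ 2 / 2))) := by
  haveI : Nonempty (RC s) := by
    obtain ⟨a, ha⟩ := hs
    exact ⟨⟨Sum.inl a, ha⟩⟩
  set F := EuclideanSpace ℝ (RC s)
  set d := Fintype.card (RC s) with hd
  have hd2 : d = 2 * s.card := card_RC s
  -- transport to the block space
  have h1 : (stdGaussian (E n)).map (fun x => ‖projE s x‖) = (stdGaussian F).map (fun y => ‖y‖) := by
    rw [← stdGaussian_map_resE s, Measure.map_map measurable_norm (measurable_resE s)]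
    congr 1
    funext x
    exact (norm_resE s x).symm
  rw [h1, stdGaussian_eq_withDensity_radial (RC s)]
  ext t ht
  have hpre : (fun y : F => ‖y‖) ⁻¹' t = (fun y : F => (dirSphere y, ‖y‖)) ⁻¹' (univ ×ˢ t) := by
    ext y; simp
  rw [Measure.map_apply measurable_norm ht, hpre, radial_rectangle (measurable_gaussRadial _)
    MeasurableSet.univ ht, finrank_euclideanSpace, ← hd, Measure.smul_apply, smul_eq_mul,
    withDensity_apply _ ht, Measure.volumeIoiPow,
    lintegral_withDensity_eq_lintegral_mul _
      (show Measurable fun r : Ioi (0 : ℝ) => ENNReal.ofReal (r.1 ^ (d - 1)) by fun_prop)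
      (show Measurable fun r : Ioi (0 : ℝ) => t.indicator (gaussRadial d) (r : ℝ) from
        ((measurable_gaussRadial d).indicator ht).comp measurable_subtype_coe)]
  have hsub := lintegral_subtype_comap (μ := (volume : Measure ℝ))
    (measurableSet_Ioi : MeasurableSet (Ioi (0 : ℝ)))
    (fun r : ℝ => ENNReal.ofReal (r ^ (d - 1)) * t.indicator (gaussRadial d) r)
  simp only [Pi.mul_apply] at hsub ⊢
  rw [hsub, mul_assoc]
  congr 1
  rw [Measure.restrict_restrict ht, ← lintegral_indicator (ht.inter measurableSet_Ioi),
    ← lintegral_indicator measurableSet_Ioi, ← lintegral_const_mul' _ _ ENNReal.ofReal_ne_top]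
  refine lintegral_congr fun r => ?_
  by_cases hr : r ∈ Ioi (0 : ℝ)
  · by_cases hrt : r ∈ t
    · have hr0 : (0 : ℝ) < r := hr
      rw [indicator_of_mem hr, indicator_of_mem hrt, indicator_of_mem (mem_inter hrt hr), gaussRadial, hd2,
        ← ENNReal.ofReal_mul (pow_nonneg hr0.le _), ← ENNReal.ofReal_mul (by positivity)]
      congr 1
      ring
    · rw [indicator_of_mem hr, indicator_of_notMem hrt, mul_zero,
        indicator_of_notMem (fun h => hrt h.1), mul_zero]
  · rw [indicator_of_notMem hr, indicator_of_notMem (fun h => hr h.2), mul_zero]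

omit [Nonempty n] in
/-- The constant `K_s` is neither zero … -/
theorem chiConst_ne_zero (s : Finset n) (hs : s.Nonempty) :
    (volume : Measure (EuclideanSpace ℝ (RC s))).toSphere univ *
        ENNReal.ofReal (((Real.sqrt (2 * Real.pi))⁻¹) ^ (2 * s.card)) ≠ 0 := by
  haveI : Nonempty (RC s) := by
    obtain ⟨a, ha⟩ := hs
    exact ⟨⟨Sum.inl a, ha⟩⟩
  refine mul_ne_zero (toSphere_univ_ne_zero _) ?_
  rw [Ne, ENNReal.ofReal_eq_zero, not_le]
  positivity

omit [Nonempty n] in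
/-- … nor infinite. -/
theorem chiConst_ne_top (s : Finset n) :
    (volume : Measure (EuclideanSpace ℝ (RC s))).toSphere univ *
        ENNReal.ofReal (((Real.sqrt (2 * Real.pi))⁻¹) ^ (2 * s.card)) ≠ ∞ :=
  ENNReal.mul_ne_top (measure_ne_top _ _) ENNReal.ofReal_ne_top

end Chi

end Summit.Ventures.LatticeQCDFlow.Exactness
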